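import Literature.NumberTheory.LFunctions.ExplicitLogFreeZeroDensityDirichlet
import HarnessLib

/-!
# Explicit Landau and Page theorems for the family of primitive characters of modulus `≤ Q`,
# and the explicit zero-free region of `∏_{q ≤ Q} ∏_{χ primitive} L(s,χ)` outside `β₁(Q)`
# (Thorner–Zaman 2024, §2.2: Lemma 2.4, Corollary 2.5, Theorem 2.6)

Topic `Literature/NumberTheory/LFunctions` (namespace `Literature.NumberTheory.LFunctions`; paper
objects in the existing sub-namespace `ThornerZaman2024` of
`ExplicitLogFreeZeroDensityDirichlet.lean`, whose `betaOne Q = β₁(Q)` and `realZeroSet Q` are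
REUSED, not re-declared). STATEMENT LAYER (D-0014/D-0064: one file for §2.2 of the source),
typed for the cell `landau-siegel` (rung F-S3, sub-cell C harvest, reader r3, row r3-T02 of
`pub/landau-siegel/lit/r3/ROWS.md`): the EXPLICIT Landau–Page constants for the whole FAMILY of
primitive characters with modulus `≤ Q`, which no decl of the tree carries (the tree has the
single-modulus explicit region `McCurley1984_theorem1` / `Kadiri2018.dirichlet_atMostOneZero` and the
INEXPLICIT family statements `DirichletZFR.exists_landau_sameLevel_min_le`,
`DirichletZFR.exists_min_realZeros_le`, PROVED). NAMED FACTS (closed `Prop`s with cites), not proved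
here, plus two proved unfoldings.

Source: J. Thorner, A. Zaman, *An explicit version of Bombieri's log-free density estimate and
Sárközy's theorem for shifted primes*, Forum Math. **36** (2024) 1059–1080 = arXiv:2208.11123
[ThornerZaman2024LogFree], §2.2, read on the held copy `paper:arxiv-2208.11123` p. 5
(p0005:L97–L140).

## What the source prints (verbatim)

"**Lemma 2.4.** Let `χ (mod q)` and `χ′ (mod q′)` be distinct real primitive characters with
`min{q,q′} > 400 000`. If `β` (resp. `β′`) is a real zero of `L(s,χ)` (resp. `L(s,χ′)`), then
`min{β,β′} < 1 − (15 − 10√2)/((5 − √5) log(q′q/17)) = 1 − 0.310 3782…/log(q′q/17)`." (Proof: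
"McCurley proved this with `q′q/17` replaced by `max{q′q/17, 13}`. When `min{q,q′} ≤ 400 000`,
Lemma 2.2 [Platt] implies that at least one of `L(s,χ)` and `L(s,χ′)` will have no real zero at
all.") "**Corollary 2.5 (Page).** Let `Q ≥ 3`. The product
`𝓜(s,Q) := ∏_{q ≤ Q} ∏_{χ (mod q) primitive quadratic} L(s,χ)` has at most one real zero in the
interval `s ≥ 1 − (15 − 10√2)/(2(5 − √5) log Q) = 1 − 0.155 1891…/log Q`. If such a real zero, say
`β₁(Q)`, exists, then `Q > 400 000`, `β₁(Q)` is a simple zero of `𝓜(s,Q)`, and there exists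
`q₁ ∈ (400 000, Q]` and a primitive quadratic character `χ₁ (mod q₁)` such that
`L(β₁(Q),χ₁) = 0`." "**Theorem 2.6.** Let `Q ≥ 3`. Let `𝓛(s,Q)` and `β₁(Q)` be as in (1.1), and let
`c = 1/9.645 908 801` be as in Lemma 2.3. Except possibly at `β₁(Q)`, `𝓛(s,Q)` is nonzero in the
region `Re(s) ≥ 1 − c/log max{Q, Q|Im(s)|}`. If `β₁(Q) ≥ 1 − c/log Q`, then `Q > 400 000`,
`β₁(Q)` is a simple zero of `𝓛(s,Q)`, there exists one primitive Dirichlet character `χ₁ (mod q₁)`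
with `q₁ ∈ (400 000, Q]` such that `L(β₁(Q),χ₁) = 0`, and `β₁(Q) ≤ 1 − 100/(√q₁ (log q₁)²)`."
(Proof: "The bound on `β₁(Q)` is proved in [Bordignon, Bordignon2]. Lemma 2.3 and Corollary 2.5
imply the rest." Here (1.1): `𝓛(s,Q) := ∏_{1 ≤ q ≤ Q} ∏_{χ (mod q) primitive} L(s,χ)`,
`β₁(Q) := max{β ∈ ℝ : 𝓛(β,Q) = 0}`.)

## Lean rendering / design choices

* `L(s,χ) = DirichletCharacter.LFunction χ s` (Mathlib). "real primitive character" =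
  `χ.IsPrimitive ∧ χ.IsQuadratic` (values in `{0, ±1}`; for Lemma 2.4 the principal character mod
  `1` is excluded automatically by `q > 400 000`, and a principal character of modulus `> 1` is not
  primitive). "distinct" for characters of possibly different moduli: `q ≠ q′`, or `q = q′` and the
  characters differ after transport (`h ▸ χ ≠ χ′`).
* Moduli `q ≤ Q` with real `Q`: `(q : ℝ) ≤ Q`; "real zero `β`": `β : ℝ` with `L(β,χ) = 0`.
* Corollary 2.5's "at most one real zero in the interval" is rendered on TRIPLES `(q, χ, β)`: two
  such triples in the window have the same `β`, the same modulus and (transported) the same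
  character. Simplicity of the zero is NOT rendered (weaker than print, deliberately — as in the
  tree's `McCurley1984_theorem1`).
* Theorem 2.6 uses the existing `ThornerZaman2024.betaOne Q` (`sSup` of the real zeros of
  `𝓛(s,Q)`, a maximum in print): part (a) every zero `ρ ≠ β₁(Q)` of a primitive `L(s,χ)`, `q ≤ Q`,
  has `Re ρ < 1 − c/log max{Q, Q|Im ρ|}`; part (b) the consequences of `β₁(Q) ≥ 1 − c/log Q`
  (simplicity again dropped).
* Constants verbatim: `(15 − 10√2)/(5 − √5)`, its half, `1/9.645908801`, `100/(√q₁ (log q₁)²)`,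
  `400 000`, `17`.

WHAT THIS IS NOT: nothing here is proved about `L`-functions; no claim about Landau–Siegel zeros.
Inexplicit Landau/Page are PROVED in the tree (`DirichletZFR.exists_landau_sameLevel_min_le`,
`DirichletZFR.exists_min_realZeros_le`, `exists_landau_prodChar_min_le`); the single-modulus explicit
region is `McCurley1984_theorem1` (open rendering) / `McCurley1984_theorem1_closed` (as printed);
Bordignon's bound is `BGTZ2025.theorem28_bordignon` (as `HypothesisB 100 (1/2)`); none is restated.
No instance, no notation.

## The primary source of Lemma 2.4 (added 2026-08-28, littype-FP2-1 g17)

The source's proof of Lemma 2.4 is one sentence: "McCurley [McCurley] proved this with `q′q/17`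
replaced by `max{q′q/17, 13}`. When `min{q,q′} ≤ 400 000`, Lemma 2.2 implies that at least one of
`L(s,χ)` and `L(s,χ′)` will have no real zero at all. This means that we may restrict consideration
to `q` and `q′` such that `max{q′q/17, 13} = q′q/17`." ([McCurley] = K. S. McCurley, *Explicit
zero-free regions for Dirichlet L-functions*, J. Number Theory 19 (1984) 7–32, the paper of the
tree's `McCurley1984_theorem1`.) McCurley's **Theorem 2** (ibid. p. 9; statement also in the
abstract p. 7; page IMAGE of the held scan rendered and read 2026-08-28 — the relation is the strict
`<`): "Let `χ₁` and `χ₂` be distinct real primitive characters modulo `k₁` and `k₂`, respectively,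
and let `βᵢ` be a real zero of `L(s, χᵢ)`, `i = 1, 2`. Let `M₁ = max{k₁k₂/17, 13}` and let
`R₁ = (5 − √5)/(15 − 10√2)`. Then `min{β₁, β₂} < 1 − 1/(R₁ log M₁)`." ("Theorem 2 was first proved
by Landau with an unspecified constant in place of `R₁`.") It is typed below as the named fact
`McCurley1984_theorem2` (all moduli, no `400 000` threshold; `1/R₁ = landauConst`), and Lemma 2.4 is
DERIVED from it (`thornerZaman2024_lemma24_of_mccurley2`: for `min{q,q′} > 400 000`,
`q′q/17 > 13`), so that the named fact `thornerZaman2024_lemma24` rests on the 1984 primary source.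

«The programme SEARCHES and TYPES; no claim about Landau–Siegel zeros, Theorems 1–2 of
arXiv:2211.02515 or a repaired Margin232 until a kernel theorem says so.»

## References

* [ThornerZaman2024LogFree] J. Thorner, A. Zaman, Forum Math. 36 (2024), doi:10.1515/forum-2023-0091,
  arXiv:2208.11123 — Lemma 2.4, Corollary 2.5, Theorem 2.6 (p. 5).
* [McCurley1984ZFR] K. S. McCurley, J. Number Theory 19 (1984) 7–32, doi:10.1016/0022-314x(84)90089-1
  — Theorem 1 (the source of `c = 1/9.645908801`; tree: `McCurley1984_theorem1`,
  `McCurley1984_theorem1_closed`) and Theorem 2 p. 9 (the source of Lemma 2.4's constant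
  `1/R₁ = (15 − 10√2)/(5 − √5)`; tree: `McCurley1984_theorem2` below). (Earlier versions of this list
  said "Math. Comp. 42 (1984)", which is McCurley's companion paper on `ψ(x; k, l)`; the source's
  [McCurley] is the J. Number Theory paper.)
* Bordignon 2019/2020 (the bound `100/(√q₁ (log q₁)²)`; tree: `BGTZ2025.theorem28_bordignon`).
-/

noncomputable section

open scoped Classical

namespace Literature.NumberTheory.LFunctions

namespace ThornerZaman2024

/-- The explicit Landau constant of Lemma 2.4: `(15 − 10√2)/(5 − √5) = 0.310 3782…`.
[cite: ThornerZaman2024LogFree, Lemma 2.4] -/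
def landauConst : ℝ :=
  (15 - 10 * Real.sqrt 2) / (5 - Real.sqrt 5)

/-- The explicit Page constant of Corollary 2.5: `(15 − 10√2)/(2(5 − √5)) = 0.155 1891…`.
[cite: ThornerZaman2024LogFree, Corollary 2.5] -/
def pageConst : ℝ :=
  (15 - 10 * Real.sqrt 2) / (2 * (5 - Real.sqrt 5))

/-- The explicit zero-free-region constant `c = 1/9.645 908 801` of Lemma 2.3 / Theorem 2.6
(McCurley). [cite: ThornerZaman2024LogFree, Lemma 2.3] -/
def zfrConst : ℝ :=
  1 / 9.645908801

/-- `pageConst = landauConst/2` (unfolding). [cite: ThornerZaman2024LogFree, Corollary 2.5] -/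
theorem pageConst_eq_half_landauConst : pageConst = landauConst / 2 := by
  unfold pageConst landauConst
  rw [div_div, mul_comm (5 - Real.sqrt 5) 2]

end ThornerZaman2024

open ThornerZaman2024

/-- **Thorner–Zaman 2024, Lemma 2.4 (explicit Landau theorem for two real primitive characters;
NAMED FACT, as printed).** "Let `χ (mod q)` and `χ′ (mod q′)` be distinct real primitive characters
with `min{q,q′} > 400 000`. If `β` (resp. `β′`) is a real zero of `L(s,χ)` (resp. `L(s,χ′)`), then
`min{β,β′} < 1 − (15 − 10√2)/((5 − √5) log(q′q/17)) = 1 − 0.310 3782…/log(q′q/17)`."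
(McCurley's constant; the small-modulus cases removed by Platt's computation.) Not proved here.
[cite: ThornerZaman2024LogFree, Lemma 2.4] -/
def thornerZaman2024_lemma24 : Prop :=
  ∀ (q q' : ℕ) [NeZero q] [NeZero q'] (χ : DirichletCharacter ℂ q) (χ' : DirichletCharacter ℂ q'),
    400000 < q → 400000 < q' → χ.IsPrimitive → χ.IsQuadratic → χ'.IsPrimitive → χ'.IsQuadratic →
      (q ≠ q' ∨ ∃ h : q = q', h ▸ χ ≠ χ') →
        ∀ β β' : ℝ, χ.LFunction β = 0 → χ'.LFunction β' = 0 →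
          min β β' < 1 - landauConst / Real.log ((q' : ℝ) * q / 17)

/-- **Thorner–Zaman 2024, Corollary 2.5 (explicit Page theorem for the family `q ≤ Q`; NAMED FACT,
as printed up to simplicity).** "Let `Q ≥ 3`. The product
`𝓜(s,Q) := ∏_{q ≤ Q} ∏_{χ (mod q) primitive quadratic} L(s,χ)` has at most one real zero in the
interval `s ≥ 1 − (15 − 10√2)/(2(5 − √5) log Q) = 1 − 0.155 1891…/log Q`. If such a real zero, say
`β₁(Q)`, exists, then `Q > 400 000`, [`β₁(Q)` is a simple zero of `𝓜(s,Q)`,] and there exists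
`q₁ ∈ (400 000, Q]` and a primitive quadratic character `χ₁ (mod q₁)` such that `L(β₁(Q),χ₁) = 0`."
Rendered: any two triples (modulus `≤ Q`, primitive quadratic character, real zero in the window)
coincide (same zero, same modulus, same character), and any one of them has modulus `> 400 000`
(hence `Q > 400 000`). Simplicity is not rendered. Not proved here.
[cite: ThornerZaman2024LogFree, Corollary 2.5] -/
def thornerZaman2024_corollary25 : Prop :=
  ∀ Q : ℝ, 3 ≤ Q →
    (∀ (q q' : ℕ) [NeZero q] [NeZero q'] (χ : DirichletCharacter ℂ q) (χ' : DirichletCharacter ℂ q'),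
      (q : ℝ) ≤ Q → (q' : ℝ) ≤ Q → χ.IsPrimitive → χ.IsQuadratic → χ'.IsPrimitive → χ'.IsQuadratic →
        ∀ β β' : ℝ, χ.LFunction β = 0 → χ'.LFunction β' = 0 →
          1 - pageConst / Real.log Q ≤ β → 1 - pageConst / Real.log Q ≤ β' →
            β = β' ∧ ∃ h : q = q', h ▸ χ = χ') ∧
    (∀ (q : ℕ) [NeZero q] (χ : DirichletCharacter ℂ q), (q : ℝ) ≤ Q → χ.IsPrimitive → χ.IsQuadratic →
      ∀ β : ℝ, χ.LFunction β = 0 → 1 - pageConst / Real.log Q ≤ β → 400000 < q)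

/-- **Thorner–Zaman 2024, Theorem 2.6, first assertion (explicit zero-free region of
`𝓛(s,Q) = ∏_{q≤Q}∏_{χ primitive} L(s,χ)` outside `β₁(Q)`; NAMED FACT, as printed).** "Let `Q ≥ 3`
… `c = 1/9.645 908 801` … Except possibly at `β₁(Q)`, `𝓛(s,Q)` is nonzero in the region
`Re(s) ≥ 1 − c/log max{Q, Q|Im(s)|}`": every zero `ρ ≠ β₁(Q)` of a primitive `L(s,χ)` of modulus
`q ≤ Q` (modulus `1` = `ζ` included; `ρ ≠ 1` excludes the pole of `ζ`, where Mathlib assigns a junk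
value) satisfies `Re ρ < 1 − c/log max{Q, Q|Im ρ|}`. `β₁(Q)` is the existing
`ThornerZaman2024.betaOne Q`. Not proved here. [cite: ThornerZaman2024LogFree, Theorem 2.6] -/
def thornerZaman2024_theorem26a : Prop :=
  ∀ Q : ℝ, 3 ≤ Q → ∀ (q : ℕ) [NeZero q] (χ : DirichletCharacter ℂ q), (q : ℝ) ≤ Q → χ.IsPrimitive →
    ∀ ρ : ℂ, ρ ≠ 1 → ρ ≠ ((betaOne Q : ℝ) : ℂ) → χ.LFunction ρ = 0 →
      ρ.re < 1 - zfrConst / Real.log (max Q (Q * |ρ.im|))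

/-- **Thorner–Zaman 2024, Theorem 2.6, second assertion (what an exceptional `β₁(Q)` forces;
NAMED FACT, as printed up to simplicity).** "If `β₁(Q) ≥ 1 − c/log Q`, then `Q > 400 000`,
[`β₁(Q)` is a simple zero of `𝓛(s,Q)`,] there exists one primitive Dirichlet character `χ₁ (mod q₁)`
with `q₁ ∈ (400 000, Q]` such that `L(β₁(Q),χ₁) = 0`, and `β₁(Q) ≤ 1 − 100/(√q₁ (log q₁)²)`"
(Bordignon's bound). Simplicity is not rendered. Not proved here.
[cite: ThornerZaman2024LogFree, Theorem 2.6] -/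
def thornerZaman2024_theorem26b : Prop :=
  ∀ Q : ℝ, 3 ≤ Q → 1 - zfrConst / Real.log Q ≤ betaOne Q →
    400000 < Q ∧ ∃ (q₁ : ℕ) (_ : NeZero q₁) (χ₁ : DirichletCharacter ℂ q₁),
      400000 < q₁ ∧ (q₁ : ℝ) ≤ Q ∧ χ₁.IsPrimitive ∧ χ₁.LFunction (betaOne Q) = 0 ∧
        betaOne Q ≤ 1 - 100 / (Real.sqrt q₁ * Real.log q₁ ^ 2)

/-! ### Bookkeeping (proved) -/

/-- The Page window is half as wide as the Landau window at `qq′/17 ≈ Q²`: numerically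
`pageConst = 0.155…` is positive (both `15 − 10√2 > 0` and `5 − √5 > 0`).
[cite: ThornerZaman2024LogFree, Corollary 2.5] -/
theorem ThornerZaman2024.pageConst_pos : 0 < pageConst := by
  unfold pageConst
  have h2 : Real.sqrt 2 < 3 / 2 := by
    rw [show (3 : ℝ) / 2 = Real.sqrt ((3 / 2) ^ 2) by rw [Real.sqrt_sq (by norm_num)]]
    exact Real.sqrt_lt_sqrt (by norm_num) (by norm_num)
  have h5 : Real.sqrt 5 < 5 / 2 := by
    rw [show (5 : ℝ) / 2 = Real.sqrt ((5 / 2) ^ 2) by rw [Real.sqrt_sq (by norm_num)]]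
    exact Real.sqrt_lt_sqrt (by norm_num) (by norm_num)
  apply div_pos <;> nlinarith

/-! ### The primary source of Lemma 2.4: McCurley 1984, Theorem 2 (explicit Landau theorem for two
real primitive characters, ALL moduli), and Lemma 2.4 derived from it -/

/-- **McCurley 1984, Theorem 2 (J. Number Theory 19 (1984), p. 9; also the abstract, p. 7 — NAMED
FACT, AS PRINTED; page image checked 2026-08-28).** "Let `χ₁` and `χ₂` be distinct real primitive
characters modulo `k₁` and `k₂`, respectively, and let `βᵢ` be a real zero of `L(s, χᵢ)`, `i = 1, 2`.
Let `M₁ = max{k₁k₂/17, 13}` and let `R₁ = (5 − √5)/(15 − 10√2)`. Then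
`min{β₁, β₂} < 1 − 1/(R₁ log M₁)`." ("Theorem 2 was first proved by Landau with an unspecified
constant in place of `R₁`.") Rendered like the tree's `thornerZaman2024_lemma24`: "real primitive
character" = `χ.IsPrimitive ∧ χ.IsQuadratic`; "distinct" for characters of possibly different moduli
= `k₁ ≠ k₂`, or `k₁ = k₂` and the characters differ after transport; "real zero `β`" = `β : ℝ` with
`L(β, χ) = 0` (every real zero, the trivial ones `β ≤ 0` included, for which the inequality is idle
since `R₁ log 13 > 1`). No threshold on the moduli (contrast Lemma 2.4's `min{q,q′} > 400 000`);
`1/R₁ = (15 − 10√2)/(5 − √5) = landauConst`. Proof in print: §§2–5 of the paper (de la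
Vallée-Poussin–Landau method with the polynomial `P(θ) = 8(0.9126 + cos θ)²(0.2766 + cos θ)²` and
Rosser–Schoenfeld-type explicit estimates); not discharged here (size L).
[cite: McCurley1984ZFR, Theorem 2] -/
def McCurley1984_theorem2 : Prop :=
  ∀ (k₁ k₂ : ℕ) [NeZero k₁] [NeZero k₂] (χ₁ : DirichletCharacter ℂ k₁) (χ₂ : DirichletCharacter ℂ k₂),
    χ₁.IsPrimitive → χ₁.IsQuadratic → χ₂.IsPrimitive → χ₂.IsQuadratic →
      (k₁ ≠ k₂ ∨ ∃ h : k₁ = k₂, h ▸ χ₁ ≠ χ₂) →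
        ∀ β₁ β₂ : ℝ, χ₁.LFunction β₁ = 0 → χ₂.LFunction β₂ = 0 →
          min β₁ β₂ <
            1 - 1 / ((5 - Real.sqrt 5) / (15 - 10 * Real.sqrt 2) *
              Real.log (max ((k₁ : ℝ) * k₂ / 17) 13))

/-- McCurley's `1/(R₁ log M)` is Thorner–Zaman's `landauConst/log M`:
`1/((5 − √5)/(15 − 10√2) · L) = ((15 − 10√2)/(5 − √5))/L`. [cite: ThornerZaman2024LogFree, Lemma 2.4] -/
theorem ThornerZaman2024.one_div_rOne_mul_eq (L : ℝ) :
    1 / ((5 - Real.sqrt 5) / (15 - 10 * Real.sqrt 2) * L) = landauConst / L := by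
  unfold landauConst
  rw [div_mul_eq_mul_div, one_div_div, div_div]

/-- **Lemma 2.4 DERIVED from McCurley's Theorem 2** (the source's one-line proof: for
`min{q,q′} > 400 000` one has `q′q/17 > 13`, so `max{q′q/17, 13} = q′q/17`; Platt's Lemma 2.2 is only
the reason the source may restrict to large moduli and is not needed for the implication):
`McCurley1984_theorem2 → thornerZaman2024_lemma24`.
[cite: ThornerZaman2024LogFree, Lemma 2.4 (proof)] [cite: McCurley1984ZFR, Theorem 2] -/
theorem thornerZaman2024_lemma24_of_mccurley2 (hM : McCurley1984_theorem2) :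
    thornerZaman2024_lemma24 := by
  intro q q' _ _ χ χ' hq hq' hprim hquad hprim' hquad' hdist β β' hz hz'
  have h := hM q q' χ χ' hprim hquad hprim' hquad' hdist β β' hz hz'
  have hqR : (400000 : ℝ) < q := by exact_mod_cast hq
  have hq'R : (400000 : ℝ) < q' := by exact_mod_cast hq'
  -- `q q'/17 ≥ 13`, so McCurley's `M₁` is `q q'/17 = q' q/17`
  have hbig : (13 : ℝ) ≤ (q : ℝ) * q' / 17 := by
    rw [le_div_iff₀ (by norm_num)]
    nlinarith
  have hmax : max ((q : ℝ) * q' / 17) 13 = (q' : ℝ) * q / 17 := by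
    rw [max_eq_left hbig, mul_comm]
  rw [hmax, ThornerZaman2024.one_div_rOne_mul_eq] at h
  exact h

end Literature.NumberTheory.LFunctions
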